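import Summits.Ventures.QEC.CircuitDistance.PortXTable
import HarnessLib

/-!
# P3-PORT (E3z): the index-0 `Z`-SECTOR TABLE — mirror of `PortXTable` for the `X`-check detectors and the residual
# `Z`-error (cell `qec`, experiment CDX, seat qec-cdx-type-1)

* `ZTable` (42 rows per code: in-cycle `X`-check flips `muX`, residual support `ez`, class `cls`, stabiliser certificate
  `cert` = `Z`-check rows), Bool checkers `ZTable.shapeRow` / `ZTable.classRow`, predicates `ShapeCorrect`/`ClassCorrect`;
* `ZTable.mX_of_table`, `ZTable.dataZb_of_table`, the fast column `ZTable.detFast` with **`ZTable.detFast_eq_zDet`**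
  (column formula `detX_singleton`: layers `c, c+1`, `Nc`-free);
* `zDEM`, `ZNontrivial` and **`classHyp_zDEM`**.
Nothing here asserts a value of `d_circ`.
-/

namespace Summit.Ventures.QEC.CircuitDistance

open Literature.InformationTheory.QuantumCodes

variable {ℓ m : ℕ}

/-- `Z`-SECTOR TABLE at base index `0`, cycle `1`: per kind its in-cycle `X`-check flips `muX`, the support `ez` of its
residual `Z`-error, its CLASS (generator support or `none`) and a stabiliser CERTIFICATE (`Z`-check rows whose sum is
`ez − gen`). -/
structure ZTable (ℓ m : ℕ) where
  /-- in-cycle `X`-check outcome flips of the kind at base index 0, cycle 1 -/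
  muX : ZKind → Finset (BB.Mono ℓ m)
  /-- support of the residual data `Z`-error -/
  ez : ZKind → Finset (BB.Mono ℓ m ⊕ BB.Mono ℓ m)
  /-- class: generator support, or `none` -/
  cls : ZKind → Option (Finset (BB.Mono ℓ m ⊕ BB.Mono ℓ m))
  /-- stabiliser certificate: `Z`-check rows -/
  cert : ZKind → Finset (BB.Mono ℓ m)

variable [NeZero ℓ] [NeZero m]

/-- SHAPE CORRECTNESS of one row (decidable: a one-cycle simulation at base index `0`, cycle `1`). -/
def ZTable.shapeRow (S : SMCode ℓ m) (T : ZTable ℓ m) (k : ZKind) : Bool :=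
  ((monoList ℓ m).all fun i => (shape S (k.fault 1 (0 : BB.Mono ℓ m))).mX 1 i == decide (i ∈ T.muX k)) &&
  ((monoList ℓ m).all fun a => ((shape S (k.fault 1 (0 : BB.Mono ℓ m))).frame.dataZb (.inl a) == decide (.inl a ∈ T.ez k)) &&
    ((shape S (k.fault 1 (0 : BB.Mono ℓ m))).frame.dataZb (.inr a) == decide (.inr a ∈ T.ez k)))

/-- SHAPE CORRECTNESS of the table. -/
def ZTable.ShapeCorrect (S : SMCode ℓ m) (T : ZTable ℓ m) : Prop := ∀ k ∈ ZKind.all, T.shapeRow S k = true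

/-- CLASS CORRECTNESS of one row: `indic ez = indic cls + Σ_{cert} H^Z-rows`. -/
def ZTable.classRow (S : SMCode ℓ m) (T : ZTable ℓ m) (k : ZKind) : Bool :=
  decide (indic (T.ez k) = indic ((T.cls k).getD ∅) + ∑ r ∈ T.cert k, fun q => S.toCode.HZ r q)

/-- CLASS CORRECTNESS of the table. -/
def ZTable.ClassCorrect (S : SMCode ℓ m) (T : ZTable ℓ m) : Prop := ∀ k ∈ ZKind.all, T.classRow S k = true

/-- What a correct shape row says. -/
theorem ZTable.shapeRow_spec {S : SMCode ℓ m} {T : ZTable ℓ m} {k : ZKind} (h : T.shapeRow S k = true) :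
    (∀ i, (shape S (k.fault 1 (0 : BB.Mono ℓ m))).mX 1 i = decide (i ∈ T.muX k)) ∧
    (∀ q, (shape S (k.fault 1 (0 : BB.Mono ℓ m))).frame.dataZb q = decide (q ∈ T.ez k)) := by
  unfold ZTable.shapeRow at h
  simp only [Bool.and_eq_true, List.all_eq_true, beq_iff_eq] at h
  obtain ⟨h1, h2⟩ := h
  refine ⟨fun i => h1 i (mem_monoList i), fun q => ?_⟩
  rcases q with a | a
  · exact (h2 a (mem_monoList a)).1
  · exact (h2 a (mem_monoList a)).2

/-- Shapes of arbitrary representatives from the table: in-cycle `X`-flips. -/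
theorem ZTable.mX_of_table {S : SMCode ℓ m} {T : ZTable ℓ m} {k : ZKind} (h : T.shapeRow S k = true) (c : ℕ)
    (i i' : BB.Mono ℓ m) : (shape S (k.fault c i)).mX c i' = decide (i' - i ∈ T.muX k) := by
  rw [ZKind.fault_eq_translate, shape_translate, ZKind.fault_eq_retag, shape_retag]
  simp only [State.translate, ZKind.cyc_fault, if_true]
  exact (ZTable.shapeRow_spec h).1 (i' - i)

/-- Shapes of arbitrary representatives from the table: residual support. -/
theorem ZTable.dataZb_of_table {S : SMCode ℓ m} {T : ZTable ℓ m} {k : ZKind} (h : T.shapeRow S k = true) (c : ℕ)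
    (i : BB.Mono ℓ m) (q : BB.Mono ℓ m ⊕ BB.Mono ℓ m) :
    (shape S (k.fault c i)).frame.dataZb q = decide (q ∈ trQ i (T.ez k)) := by
  rw [ZKind.fault_eq_translate, shape_translate, dataZb_translate, ZKind.fault_eq_retag, shape_retag]
  exact ((ZTable.shapeRow_spec h).2 _).trans (decide_eq_decide.mpr (mem_trQ i _ q).symm)

/-! ## The fast column -/

/-- The true `Z`-sector column detector set of a fault: `{(t − 1, i) : detX S Nc {f} t i}`. -/
def zDet (S : SMCode ℓ m) (Nc : ℕ) (f : Fault ℓ m) : Finset (ℕ × BB.Mono ℓ m) :=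
  ((Finset.range (Nc + 2)) ×ˢ (Finset.univ : Finset (BB.Mono ℓ m))).filter fun p => detX S Nc {f} (p.1 + 1) p.2

/-- The column FORMULA of `detX_singleton` evaluated on table data. -/
def ZTable.colFormula (S : SMCode ℓ m) (T : ZTable ℓ m) (k : ZKind) (i : BB.Mono ℓ m) (c s : ℕ) (i' : BB.Mono ℓ m) :
    Bool :=
  let μ := decide (i' - i ∈ T.muX k)
  let σ := synX S (fun q => decide (q ∈ trQ i (T.ez k))) i'
  xor (decide (s + 1 = c) && μ) (decide (s + 1 = c + 1) && xor μ σ)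

/-- FAST `Z`-SECTOR COLUMN: the `X`-check detectors `(layer − 1, check)` of kind `k` at base index `i`, cycle `c` (only
layers `c−1, c` can occur; `Nc`-free). -/
def ZTable.detFast (S : SMCode ℓ m) (T : ZTable ℓ m) (k : ZKind) (i : BB.Mono ℓ m) (c : ℕ) : Finset (ℕ × BB.Mono ℓ m) :=
  (({c - 1, c} : Finset ℕ) ×ˢ (Finset.univ : Finset (BB.Mono ℓ m))).filter fun p => T.colFormula S k i c p.1 p.2

/-- The formula IS the column of the representative. -/
theorem ZTable.colFormula_eq {S : SMCode ℓ m} {T : ZTable ℓ m} {k : ZKind} (h : T.shapeRow S k = true) (Nc : ℕ)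
    (i : BB.Mono ℓ m) (c : ℕ) (h₁ : 1 ≤ c) (h₂ : c ≤ Nc) (s : ℕ) (i' : BB.Mono ℓ m) :
    T.colFormula S k i c s i' = detX S Nc {k.fault c i} (s + 1) i' := by
  have hc : (k.fault c i : Fault ℓ m).cyc = c := ZKind.cyc_fault k c i
  rw [detX_singleton S Nc (k.fault c i) (by rw [hc]; exact h₁) (by rw [hc]; exact h₂), hc, ZTable.mX_of_table h c i i']
  have hd : (shape S (k.fault c i)).frame.dataZb = fun q => decide (q ∈ trQ i (T.ez k)) :=
    funext fun q => ZTable.dataZb_of_table h c i q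
  rw [hd]
  rfl

/-- **The fast column is the column.** -/
theorem ZTable.detFast_eq_zDet {S : SMCode ℓ m} {T : ZTable ℓ m} {k : ZKind} (h : T.shapeRow S k = true) (Nc : ℕ)
    (i : BB.Mono ℓ m) (c : ℕ) (h₁ : 1 ≤ c) (h₂ : c ≤ Nc) : T.detFast S k i c = zDet S Nc (k.fault c i) := by
  ext ⟨s, i'⟩
  simp only [ZTable.detFast, zDet, Finset.mem_filter, Finset.mem_product, Finset.mem_univ, and_true, Finset.mem_range,
    Finset.mem_insert, Finset.mem_singleton, ZTable.colFormula_eq h Nc i c h₁ h₂]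
  constructor
  · rintro ⟨hs, hd⟩
    refine ⟨?_, hd⟩
    rcases hs with rfl | rfl
    · omega
    · omega
  · rintro ⟨-, hd⟩
    refine ⟨?_, hd⟩
    have hc : (k.fault c i : Fault ℓ m).cyc = c := ZKind.cyc_fault k c i
    rw [detX_singleton S Nc (k.fault c i) (by rw [hc]; exact h₁) (by rw [hc]; exact h₂), hc] at hd
    by_contra hne
    push Not at hne
    have e1 : ¬ (s + 1 = c) := by omega
    have e2 : ¬ (s + 1 = c + 1) := by omega
    rw [decide_eq_false e1, decide_eq_false e2] at hd
    simp at hd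

/-! ## The `Z`-sector DEM and its class hypothesis -/

/-- `Z`-NONTRIVIAL residual: zero `X`-syndrome and not a `Z`-stabiliser. -/
def ZNontrivial (S : SMCode ℓ m) (v : BB.Mono ℓ m ⊕ BB.Mono ℓ m → ZMod 2) : Prop :=
  S.toCode.HX.mulVec v = 0 ∧ v ∉ rowSpace S.toCode.HZ

/-- The `Z`-sector DEM of the `Nc`-cycle circuit with classes read off the table `T`. -/
def zDEM (S : SMCode ℓ m) (T : ZTable ℓ m) (Nc : ℕ) :
    Fibre.DEM (Fault ℓ m) (ℕ × BB.Mono ℓ m) (Finset (BB.Mono ℓ m ⊕ BB.Mono ℓ m)) (BB.Mono ℓ m ⊕ BB.Mono ℓ m → ZMod 2) where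
  det := zDet S Nc
  res := fun f => dataZ S Nc {f}
  cls := fun f => f.zKind.bind fun ki => (T.cls ki.1).map (trQ ki.2)
  gen := indic
  stab := rowSpace S.toCode.HZ

/-- A row of `H^Z` is a `Z`-stabiliser. -/
theorem HZ_row_mem_rowSpace (S : SMCode ℓ m) (r : BB.Mono ℓ m) : (fun q => S.toCode.HZ r q) ∈ rowSpace S.toCode.HZ := by
  refine mem_rowSpace_of_vecMul_eq (Pi.single r 1) ?_
  funext q
  rw [Matrix.vecMul, dotProduct]
  simp only [Pi.single_apply]
  rw [Finset.sum_eq_single r]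
  · simp
  · intro b _ hb; simp [hb]
  · intro h; exact absurd (Finset.mem_univ r) h

/-- A translated `H^Z` row is an `H^Z` row. -/
theorem HZ_row_translate (S : SMCode ℓ m) (r t : BB.Mono ℓ m) :
    (fun q => S.toCode.HZ r ((BB.Code.translate t).symm q)) = fun q => S.toCode.HZ (r + t) q := by
  funext q
  have := BB.Code.HZ_translate S.toCode t r ((BB.Code.translate t).symm q)
  rw [Equiv.apply_symm_apply] at this
  exact this.symm

/-- **Class hypothesis of the `Z`-sector DEM** from a shape- and class-correct table. -/
theorem classHyp_zDEM (S : SMCode ℓ m) (T : ZTable ℓ m) (hS : T.ShapeCorrect S) (hC : T.ClassCorrect S) (Nc : ℕ) :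
    Fibre.ClassHyp (zDEM S T Nc) (scope Nc) := by
  intro f hf
  obtain ⟨h₁, h₂⟩ := hf
  rcases hk : f.zKind with _ | ⟨k, i⟩
  · have h0 := (zColumn_zero_of_zKind S Nc f hk).2
    refine ⟨fun _ => ?_, fun g hg => ?_⟩
    · show dataZ S Nc {f} ∈ rowSpace S.toCode.HZ; rw [h0]; exact Submodule.zero_mem _
    · simp [zDEM, hk] at hg
  · have hkall : k ∈ ZKind.all := ZKind.mem_all k (fun lay => Fault.zKind_ne_zero hk lay)
    have hrow := hS k hkall
    have hcls := hC k hkall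
    unfold ZTable.classRow at hcls
    rw [decide_eq_true_eq] at hcls
    have hres : dataZ S Nc {f} = indic (trQ i (T.ez k)) := by
      rw [(zColumn_eq_of_zKind S Nc f hk).2, dataZ_singleton S Nc (k.fault f.cyc i) (by rw [ZKind.cyc_fault]; exact h₁)
        (by rw [ZKind.cyc_fault]; exact h₂)]
      funext q; unfold toZ2 indic; rw [ZTable.dataZb_of_table hrow]
      by_cases hq : q ∈ trQ i (T.ez k) <;> simp [hq]
    have hsum : indic (trQ i (T.ez k)) = indic (trQ i ((T.cls k).getD ∅)) + ∑ r ∈ T.cert k, fun q => S.toCode.HZ (r + i) q := by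
      rw [indic_trQ, indic_trQ, hcls]
      funext q
      simp only [Pi.add_apply, Finset.sum_apply]
      congr 1
      apply Finset.sum_congr rfl
      intro r _
      exact congrFun (HZ_row_translate S r i) q
    have hstab : (∑ r ∈ T.cert k, fun q => S.toCode.HZ (r + i) q) ∈ rowSpace S.toCode.HZ :=
      Submodule.sum_mem _ fun r _ => HZ_row_mem_rowSpace S (r + i)
    refine ⟨fun hnone => ?_, fun g hg => ?_⟩
    · simp only [zDEM, hk, Option.bind_some] at hnone
      rw [Option.map_eq_none_iff] at hnone
      show dataZ S Nc {f} ∈ rowSpace S.toCode.HZ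
      rw [hres, hsum, hnone]
      simp only [Option.getD_none]
      have : indic (trQ i (∅ : Finset (BB.Mono ℓ m ⊕ BB.Mono ℓ m))) = 0 := by
        funext q; simp [indic, trQ]
      rw [this, zero_add]; exact hstab
    · simp only [zDEM, hk, Option.bind_some] at hg
      obtain ⟨g₀, hg₀, rfl⟩ := Option.map_eq_some_iff.1 hg
      show dataZ S Nc {f} - indic (trQ i g₀) ∈ rowSpace S.toCode.HZ
      rw [hres, hsum, hg₀]
      simp only [Option.getD_some, add_sub_cancel_left]
      exact hstab

end Summit.Ventures.QEC.CircuitDistance
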